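import Summits.PneNP.PneNP.Theses.PhaseTwins
import Summits.PneNP.PneNP.Theorems.PseudorandomTwinsAbove.Negative.FalseWithoutPolyTime
import Literature.Computability.Complexity.HardcoreInapproximability
import Literature.Computability.Complexity.GapAssembly
import Literature.Computability.Complexity.ApproximationProofs
import Literature.Computability.Complexity.PairProjections
import Literature.Computability.Complexity.PromiseProofs
import Literature.Computability.Complexity.KarpCliqueGadget
import Literature.Computability.Complexity.CountingHierarchyProofs
import Literature.Computability.Complexity.StringEquality
import Literature.Computability.Cryptography.PseudorandomGeneratorsAnyOWF
import Literature.Computability.Cryptography.PseudorandomnessProofs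
import Literature.Computability.Cryptography.PRGStretchExtensionReduction
import Literature.Computability.Cryptography.IndistinguishabilityPostProcessing

/-!
# Line `prg-image-exact-threshold-lift` for crux `PhaseTwins.PseudorandomTwinsAbove` (stmt-PneNP-2721)

Lead prover's RESHAPED skeleton (prover-line-stmt-PneNP-2721-0, 2026-08-16), built on the planner's
checked skeleton `Lines/prg-image-exact-threshold-lift.lean` (planner-cruxplan-stmt-PneNP-2721-prg-image-exact-thre-0).

THE LINE (transport, unchanged in substance). `OWFExist` (the HYPOTHESIS, by name) ⇒ `PRGExist`
(HILL, PROVED: `PRGExist_of_OWFExist`) ⇒ (S1) PRG-image source twins `X₀ = G(U_n)`, `X₁ = U_{ℓ n}`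
⇒ push BOTH through ONE map `T = f ∘ d ∘ ⟨g, id⟩ ∈ FP`:
(S2a) `g` = Cook–Levin ∘ the tree's Dinur gap machine `GapPV.ggMachine` — whose output ALREADY has
bounded variable occurrence (the last Dinur round ends with degree reduction + constant-size tester
constraints; the E3 rendering `BCSP.toE3CNF` keeps occurrences bounded) — so the planner's
`stub_occurrenceReduction` (expander replacement, a new FP machine) is REPLACED by a counting lemma on
the tree's own reduction; (S2b) `d` = duplicate-with-disjoint-copies-and-pad to an exact clause count
`m(|y|)` (shape uniformity, value gap kept up to `κ = 1/3`, occurrences kept); (S4a) `f` = the code of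
the CONFLICT graph of the E3-CNF (Karp's 3SAT → INDEPENDENT-SET graph: one vertex per literal
occurrence, edges inside a clause and between complementary occurrences — the complement of Karp's
CLIQUE graph `KarpClique.graphOf`, computed by the same token/emitter bricks), (S4b) whose independence
number is `m · val(φ)`, whose max degree is `≤ B + 2`, and whose hard-core count at `(Δ, p, q) =
(B + 3, 2^K, 1)` separates YES (`N ≥ 2^{Km} = 8τ`) from NO (`N ≤ 2^{3m + K(1-γ)m} ≤ τ`) by a factor 8
for `K ≥ max (6/γ) Δ` — ⇒ `D_b := T_* X_b` samplable, indistinguishable with the index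
(`IsCompIndistinguishable.map_fp`, PROVED), hence (S5) index-free `o(1)`-indistinguishable, and clause
(ii) with `t n := τ (m (ℓ n))`.

Stubs (6, all provable now from tree material; registered by `ledger skeleton check`):
`stub_prgImageTwins` (S1, M), `stub_gapE3SATB` (S2a, M–L: occurrence count of the last Dinur round —
held by the lead), `stub_dupPad` (S2b, L: a typed `CodeFP` program), `stub_conflictGraphFn` (S4a, M:
`KarpCliqueReduction` emitter loop with the conflict emitter), `stub_conflictGraphGap` (S4b, M–L:
independent sets of the conflict graph + counting window), `stub_clauseI` (S5, M).
Hypothesis (by name, NOT a stub): `OWFExist` (triage F1: every line on this crux is `H → crux` with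
`H ⇒ PneNP`).  The skeleton theorem `PseudorandomTwinsAbove_of (hOWF : OWFExist)` uses the stubs BY NAME,
has no `sorry` of its own and concludes `Summit.PneNP.PneNP.Theses.PhaseTwins.PseudorandomTwinsAbove`
BY NAME (the route's inlined count/threshold are `hardcoreCount`/`hardCoreThreshold`, `rfl`).

Disproof.lean (cdisprove cycles 1–2) honoured: the time bound `A.IsPolyTime` enters only at
`stub_clauseI`; positivity `0 < N` is PROVED (empty independent set) inside `stub_conflictGraphGap`;
both laws sit on ONE common length per `n` (`no_twins_at_distinct_lengths`); DFA / length tests are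
fooled by inheritance from the PRG; `D₀ n`, `D₁ n` ARE statistically far (only computational
indistinguishability is claimed).
-/

set_option linter.unusedVariables false
set_option linter.dupNamespace false

noncomputable section

namespace Summit.PneNP.PneNP.Cruxes.PseudorandomTwinsAbove.PrgImageExactThresholdLift

open Filter
open Literature.Computability.Complexity Literature.Computability.MetaComplexity
open Literature.Computability.Cryptography (OWFExist PRGExist IsPRG IsCompIndistinguishable uniformBits
  PRGExist_of_OWFExist)
open Literature.Probability.LatticeModels (hardCoreThreshold)
open _root_.Computability
open Summit.PneNP.PneNP.Theses.PhaseTwins (PseudorandomTwinsAbove)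

/-! ## Sanity links (PROVED in the tree; nothing assumed) -/

/-- The PCP theorem in Karp form is a THEOREM of the tree (Dinur on the Gabber–Galil kit). -/
example : ∃ ε₁ : ℚ, 0 < ε₁ ∧ ε₁ ≤ 1 / 8 ∧ (gapE3SAT (1 / 8 - ε₁)).IsNPHard :=
  ⟨_, GapPV.ε₁Q_pos _, GapPV.ε₁Q_le _, gapE3SAT_isNPHard_of_gapMachine GapPV.ggMachine (GapPV.ε₁Q_le _)⟩

/-- HILL is proved in the tree: the line's hypothesis `OWFExist` already yields a PRG. -/
example (h : OWFExist) : PRGExist := PRGExist_of_OWFExist h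

open scoped Classical in
/-- The route's inlined hard-core count IS `hardcoreCount Δ p q` (definitionally). -/
example (Δ p q : ℕ) (x : List Bool) : hardcoreCount Δ p q x =
    (match encodingGraph.decode x with
      | none => 0
      | some G => if G.2.maxDegree ≤ Δ then ∑ I : Finset (Fin G.1),
          (if G.2.IsIndepSet (↑I : Set (Fin G.1)) then p ^ I.card * q ^ (G.1 - I.card) else 0) else 0) :=
  rfl

/-! ## The stubs -/

/-- **S1 — PRG-image source twins.** From a PRG obtain: an `NP` language `L`, a strictly monotone
polynomially bounded length map `ℓ`, and two EXACTLY samplable ensembles `X₀`, `X₁` supported on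
`{0,1}^{ℓ n}`, computationally indistinguishable WITH the index (`IsCompIndistinguishable`, negligible
advantage), with `X₀ n` supported inside `L` and `Pr_{X₁ n}[L] → 0`. Why true: `PRGExist` gives a PRG
of stretch `n+1` (`exists_isPRG_succ_of_PRGExist`, PROVED) and then one of stretch `ℓ n = 2n + 2`
(`exists_isPRG_of_stretch_succ_holds`, PROVED); `X₀ n := (uniformBits n).map G`, `X₁ n := uniformBits
(2n+2)`, `L := Im G ∈ NP` (witness = seed), `Pr_{U_{2n+2}}[Im G] ≤ 2^n · 2^{-(2n+2)} → 0`. Size M. -/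
theorem stub_prgImageTwins : PRGExist →
    ∃ (L : Language Bool) (ℓ : ℕ → ℕ) (X₀ X₁ : Ensemble),
      L ∈ Nondeterministic.NP ∧ StrictMono ℓ ∧ (∃ P : Polynomial ℕ, ∀ n, ℓ n ≤ P.eval n) ∧
      X₀.IsPolySamplable ∧ X₁.IsPolySamplable ∧ IsCompIndistinguishable X₀ X₁ ∧
      (∀ n, ∀ s ∈ (X₀ n).support, s.length = ℓ n) ∧ (∀ n, ∀ s ∈ (X₁ n).support, s.length = ℓ n) ∧
      (∀ n, ∀ s ∈ (X₀ n).support, s ∈ L) ∧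
      Tendsto (fun n : ℕ => X₁.prob n {s | s ∈ L}) atTop (nhds 0) := by
  sorry

/-- **S2a — bounded-occurrence gap-E3SAT is NP-hard, from the tree's own PCP machine.** For every
`NP` language `L` there are `g ∈ FP`, a gap `γ > 0` and an occurrence bound `B` such that `g` maps
EVERY string `y` to the code of an E3-CNF in which every variable occurs in at most `B` clauses,
satisfiable if `y ∈ L` and of value `≤ 1 - γ` if `y ∉ L`. Why true: `g := GapPV.ggMachine.g ∘ r` with
`r` the Cook–Levin map to `kSAT 3` (`isNPComplete_kSAT_three_holds`); on the code of a width-`≤ 3` CNF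
`φ` the machine outputs the code of `ggP.dinur φ = (ggP.iterate (log₂ m + 1) (ofCNF q₀ φ)).toE3CNF`
(`GapPV.F_sn_encode`, `strFn_apply`), elsewhere the code of `noE3` (8 clauses); `γ := GapPV.ε₁Q ggP`.
The occurrence bound (the NEW content, replacing the planner's expander stub): the last round's output
`powAlpha` has constraints `(s, c)` (walk `s = (v, label)`, coins `c ∈ TCoins k₄`, `|TCoins k₄| = tc k₄`
a constant) reading only variables `Sum.inl (wfst s, ·)`, `Sum.inl (wsnd s, ·)`, `Sum.inr (s, ·)`
(`BLR.Table.posVar`/`consVars`), so a variable is read by at most `(D^{2t+1} + ballBound D (2t+1) ·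
D^{2t+1} + 1) · tc k₄` constraints (walks ending at `v` start in the ball around `v`:
`start_mem_ballList_endpt`, `length_ballList_le`); `BCSP.toE3CNF` then puts an old variable only in the
`≤ 2^{q₀} (q₀ + 4)` gadget clauses of the constraints reading it and a fresh variable in `≤ 2 (q₀ + 4)`
clauses (`fresh_decode`). Size M–L (held by the lead). -/
theorem stub_gapE3SATB : ∀ L : Language Bool, L ∈ Nondeterministic.NP →
    ∃ (g : List Bool → List Bool) (γ : ℚ) (B : ℕ), g ∈ FP ∧ 0 < γ ∧
      ∀ y : List Bool, ∃ φ : CNF ℕ, g y = encodingCNF.encode φ ∧ φ.IsExactWidth 3 ∧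
        (∀ v : ℕ, (φ.countP fun cl => v ∈ cl.map Prod.fst) ≤ B) ∧
        (y ∈ L → φ.Satisfiable) ∧ (y ∉ L → φ.maxSatFraction ≤ 1 - γ) := by
  sorry

/-- **S2b — shape uniformiser: disjoint duplication and padding (a typed `CodeFP` program).** For every
exponent `a` there are `d ∈ FP`, a STRICTLY MONOTONE positive clause-count map `m` and `κ > 0` such that
on `⟨code φ, y⟩` with `φ` an E3-CNF of at most `(|y| + 2)^a` clauses, `d` outputs the code of an E3-CNF
`ψ` with EXACTLY `m |y|` clauses, occurrences bounded by `max B 1` when those of `φ` are bounded by `B`,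
satisfiable if `φ` is, and of value `≤ 1 - κ γ` whenever `val φ ≤ 1 - γ`. Why true: with `ℓ := |y|`,
`M' := (ℓ+2)^a + ℓ`, `c := |φ|`, `k := ⌈M'/c⌉` (`0` if `c = 0`), `ψ := ⋃_{i<k} φ[v ↦ 2(vk+i)] ++`
`(m ℓ - kc)` fresh positive clauses `(2(3j)+1) ∨ (2(3j+1)+1) ∨ (2(3j+2)+1)`, `m ℓ := 2M' + 1`
(`kc ≤ M' + c - 1 ≤ 2M' - 1`): copies are variable-disjoint and isomorphic to `φ`, so every assignment
violates `≥ kγc ≥ γ M'` clauses, a fraction `≥ γ M'/(2M'+1) ≥ γ/3`; `κ := 1/3`. `d ∈ FP` by the typed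
combinators of `CodeFP.lean` (`listE`/`pairE`/`natE` ARE `encodingCNF`'s codes: `listE_eq`, `pairE_eq`;
`map`, `flatten`, `brange`, `natMul`, `natAdd`, `natLe`, `ulength`, `foldl`). Size L. -/
theorem stub_dupPad : ∀ a : ℕ,
    ∃ (d : List Bool → List Bool) (m : ℕ → ℕ) (κ : ℚ), d ∈ FP ∧ StrictMono m ∧ (∀ k, 0 < m k) ∧ 0 < κ ∧
      ∀ (φ : CNF ℕ) (y : List Bool), φ.IsExactWidth 3 → φ.length ≤ (y.length + 2) ^ a →
        ∃ ψ : CNF ℕ, d (boolPair (encodingCNF.encode φ) y) = encodingCNF.encode ψ ∧ ψ.IsExactWidth 3 ∧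
          ψ.length = m y.length ∧
          (∀ B : ℕ, (∀ v : ℕ, (φ.countP fun cl => v ∈ cl.map Prod.fst) ≤ B) →
            ∀ v : ℕ, (ψ.countP fun cl => v ∈ cl.map Prod.fst) ≤ max B 1) ∧
          (φ.Satisfiable → ψ.Satisfiable) ∧
          (∀ γ : ℚ, φ.maxSatFraction ≤ 1 - γ → ψ.maxSatFraction ≤ 1 - κ * γ) := by
  sorry

/-- **S4a — the conflict-graph code is computed in `FP`.** Some `f ∈ FP` maps the code of EVERY CNF `φ`
to the code (`encodingGraph`) of its CONFLICT graph on the annotated literal occurrences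
`A := KarpClique.annot 0 φ` (clause number, binary variable, polarity): occurrences `p ≠ q` are
adjacent iff they lie in the same clause on different variables, or carry the same variable with
opposite polarities (Karp's 3SAT → INDEPENDENT SET graph; the complement of `KarpClique.graphOf A`
inside clauses). Why true: `KarpCliqueReduction.lean` computes `KarpClique.graphOf` by the generic
clause-counting matrix loop `cmatFn E` over the tokenizer `tokFn` with the emitter `E := adjE`; replace
the emitter by `conflE := orFn (andFn clsEqT (notFn numEqT)) (andFn numEqT (notFn polEqT))` (one bit,
`FP`, value on descriptors by `clsEqT_desc`/`numEqT_desc`/`polEqT_desc`), reuse `cmatFn_mem_FP`,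
`cmatM_tokRec`, `crowM_tokRec`, `toks_encode`, `annFrom_tokensStr`, the `adjBits` bridge
(`adjBits_graphOf` verbatim with the new Boolean) and project the graph component
(`f := fstF ∘ …` of `instEnc_encode_eq`, or assemble `⟨bin L, bits⟩` directly). Size M. -/
theorem stub_conflictGraphFn :
    ∃ f : List Bool → List Bool, f ∈ FP ∧ ∀ φ : CNF ℕ,
      f (encodingCNF.encode φ) = encodingGraph.encode ⟨(KarpClique.annot 0 φ).length,
        SimpleGraph.fromRel fun p q : Fin (KarpClique.annot 0 φ).length =>
          ((KarpClique.annot 0 φ)[p].1 = (KarpClique.annot 0 φ)[q].1 ∧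
              (KarpClique.annot 0 φ)[p].2.1 ≠ (KarpClique.annot 0 φ)[q].2.1) ∨
          ((KarpClique.annot 0 φ)[p].2.1 = (KarpClique.annot 0 φ)[q].2.1 ∧
              (KarpClique.annot 0 φ)[p].2.2 ≠ (KarpClique.annot 0 φ)[q].2.2)⟩ := by
  sorry

/-- **S4b — the counting window on conflict graphs of bounded-occurrence E3-CNFs (where the crux's free
`∃ Δ p q` is spent).** For every occurrence bound `B` and gap `γ > 0` there are `(Δ, p, q)` above the
uniqueness threshold, a threshold map `τ` and a strictly monotone code-length map `len` such that for
every E3-CNF `φ` with `m > 0` clauses and occurrences `≤ B`, the code `x` of its conflict graph has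
length `len m`, `φ` satisfiable ⇒ `N x ≥ 8 τ m`, and `val φ ≤ 1 - γ` ⇒ `0 < N x ≤ τ m`
(`N = hardcoreCount Δ p q`). Why true: `|A| = 3m` (exact width 3); independent sets = choices of at
most one literal occurrence per clause with no complementary pair, so `α = max_σ #sat(σ) = m · val φ`
(YES `α = m`, NO `α ≤ (1-γ) m`); max degree `≤ 2 + B` (two clause mates, `≤ B` complementary
occurrences), so with `Δ := B + 3` the promise `maxDegree ≤ Δ` holds and
`hardcoreCount_encode_of_maxDegree_le` gives `N = Σ_{I indep} p^{|I|} q^{3m-|I|}`; take `q := 1`,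
`p := 2^K`, `K := max ⌈6/γ⌉₊ Δ` (so `(Δ-1)^{Δ-1} < 2^Δ (Δ-2)^Δ ≤ 2^K (Δ-2)^Δ`, i.e.
`hardCoreThreshold Δ < 2^K`), `τ m := 2^{Km-3}`: `2^{Kα} ≤ N ≤ 2^{3m} 2^{Kα}` gives YES `N ≥ 2^{Km} =
8 τ m`, NO `N ≤ 2^{3m + K(1-γ)m} ≤ 2^{Km-3}` (`Kγm ≥ 6m ≥ 3m + 3`), `0 < N` from `I = ∅`;
`len m := |encodingGraph.encode ⟨3m, ·⟩| = 2 |bin (3m)| + 2 + 9m²` (`encodingGraph_encode`,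
`length_boolPair`, `CliqueNP.encodingGraphFin_encode_eq`), strictly monotone. Size M–L. -/
theorem stub_conflictGraphGap : ∀ (B : ℕ) (γ : ℚ), 0 < γ →
    ∃ (Δ p q : ℕ) (τ len : ℕ → ℕ), 3 ≤ Δ ∧ 0 < q ∧ hardCoreThreshold Δ < (p : ℝ) / q ∧ StrictMono len ∧
      ∀ φ : CNF ℕ, φ.IsExactWidth 3 → (∀ v : ℕ, (φ.countP fun cl => v ∈ cl.map Prod.fst) ≤ B) →
        0 < φ.length → ∀ x : List Bool,
        x = encodingGraph.encode ⟨(KarpClique.annot 0 φ).length,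
          SimpleGraph.fromRel fun p q : Fin (KarpClique.annot 0 φ).length =>
            ((KarpClique.annot 0 φ)[p].1 = (KarpClique.annot 0 φ)[q].1 ∧
                (KarpClique.annot 0 φ)[p].2.1 ≠ (KarpClique.annot 0 φ)[q].2.1) ∨
            ((KarpClique.annot 0 φ)[p].2.1 = (KarpClique.annot 0 φ)[q].2.1 ∧
                (KarpClique.annot 0 φ)[p].2.2 ≠ (KarpClique.annot 0 φ)[q].2.2)⟩ →
        x.length = len φ.length ∧
        (φ.Satisfiable → 8 * τ φ.length ≤ hardcoreCount Δ p q x) ∧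
        (φ.maxSatFraction ≤ 1 - γ → 0 < hardcoreCount Δ p q x ∧ hardcoreCount Δ p q x ≤ τ φ.length) := by
  sorry

/-- **S5 — index-fed negligible indistinguishability ⇒ the crux's INDEX-FREE clause (i), for
fixed-length ensembles.** If `X n`, `Y n` are supported on `{0,1}^{ℓ' n}` with `ℓ'` STRICTLY MONOTONE
and `IsCompIndistinguishable X Y` (tests fed `⟨1ⁿ, x⟩`, negligible advantage), then every PPT index-free
test `A` (`A.IsPolyTime id encodeBool`; free polynomially bounded `coinLen`) has acceptance gap `→ 0`.
Why true: simulate `A` by `D.run z r := A.run (boolUnpair z).2 r`, `D.coinLen (2n + 2 + ℓ' n) :=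
A.coinLen (ℓ' n)` (well defined: `n ↦ 2n + 2 + ℓ' n` is injective for monotone `ℓ'`), `D` is PPT
(`boolUnpairSnd_mem_FP`, `PolyTimeComputable.comp_holds`), on the support `acceptPMF D n (X n) true =
Σ' x, X n x · A.pr id x {true}`, so `distAdvantage D X Y n` IS the gap; negligible ⇒ `→ 0`. The ONLY
place where the time bound on the tests is used (`Negative.pseudorandomTwinsAbove_false_without_polyTime`).
Size M. -/
theorem stub_clauseI : ∀ (X Y : Ensemble) (ℓ' : ℕ → ℕ), StrictMono ℓ' →
    (∀ n, ∀ x ∈ (X n).support, x.length = ℓ' n) → (∀ n, ∀ y ∈ (Y n).support, y.length = ℓ' n) →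
    IsCompIndistinguishable X Y →
    ∀ A : RandAlg (List Bool) Bool, A.IsPolyTime (id : List Bool → List Bool) encodeBool →
      Tendsto (fun n : ℕ => |(∑' x : List Bool, ((X n) x).toReal * A.pr id x {b | b = true}) -
        (∑' x : List Bool, ((Y n) x).toReal * A.pr id x {b | b = true})|) atTop (nhds 0) := by
  sorry

/-! ## Proved glue -/

/-- `PSamp` is closed under `FP` push-forwards (run the sampler, then the map; same coins). -/
theorem isPolySamplable_map' {D : Ensemble} (hD : D.IsPolySamplable) {g : List Bool → List Bool}
    (hg : g ∈ FP) : Ensemble.IsPolySamplable fun n => (D n).map g := by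
  obtain ⟨S, ⟨hS, p, hp⟩, hout⟩ := hD
  refine ⟨⟨fun n r => g (S.run n r), S.coinLen⟩, ⟨?_, p, hp⟩, fun n => ?_⟩
  · exact PolyTimeComputable.comp_holds hg hS
  · show RandAlg.outputPMF _ unaryEncodeNat n = (D n).map g
    rw [← hout n]
    simp only [RandAlg.outputPMF, PMF.map_comp]
    rfl

/-- Every natural polynomial is dominated by a power of `n + 2`. -/
theorem poly_le_pow (s : Polynomial ℕ) : ∃ a : ℕ, ∀ n : ℕ, s.eval n ≤ (n + 2) ^ a := by
  induction s using Polynomial.induction_on' with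
  | add p q hp hq =>
    obtain ⟨a, ha⟩ := hp
    obtain ⟨b, hb⟩ := hq
    refine ⟨max a b + 1, fun n => ?_⟩
    rw [Polynomial.eval_add, pow_succ]
    have h2 : 2 ≤ n + 2 := by omega
    have hpa : (n + 2) ^ a ≤ (n + 2) ^ max a b := Nat.pow_le_pow_right (by omega) (le_max_left _ _)
    have hpb : (n + 2) ^ b ≤ (n + 2) ^ max a b := Nat.pow_le_pow_right (by omega) (le_max_right _ _)
    calc p.eval n + q.eval n ≤ (n + 2) ^ max a b + (n + 2) ^ max a b := Nat.add_le_add ((ha n).trans hpa) ((hb n).trans hpb)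
      _ = (n + 2) ^ max a b * 2 := by ring
      _ ≤ (n + 2) ^ max a b * (n + 2) := Nat.mul_le_mul_left _ h2
  | monomial k c =>
    refine ⟨c + k, fun n => ?_⟩
    rw [Polynomial.eval_monomial, pow_add]
    have hc : c ≤ (n + 2) ^ c :=
      (Nat.lt_two_pow_self).le.trans (Nat.pow_le_pow_left (by omega) c)
    exact Nat.mul_le_mul hc (Nat.pow_le_pow_left (by omega) k)

/-! ## The composition (kernel-checked; no `sorry` of its own) -/

/-- **`OWFExist` ⇒ S1 ⇒ (S2a, S2b, S4a = one shape-uniform Karp map) ⇒ push-forward twins ⇒ S4b, S5 ⇒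
the crux.** The skeleton theorem: its only hypothesis is the registered conjecture `OWFExist` (by name);
it uses the six stubs BY NAME and concludes `Summit.PneNP.PneNP.Theses.PhaseTwins.PseudorandomTwinsAbove`
by name; no `sorry` of its own (its axiom closure is that of the stubs). -/
theorem PseudorandomTwinsAbove_of (hOWF : OWFExist) : PseudorandomTwinsAbove := by
  -- S0 (hypothesis) ⇒ PRG (HILL, proved) ⇒ S1: the source twins
  obtain ⟨L, ℓ, X₀, X₁, hL, hℓ, hℓpoly, hX₀, hX₁, hind, hlen₀, hlen₁, hsub, hmiss⟩ :=
    stub_prgImageTwins (PRGExist_of_OWFExist hOWF)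
  -- S2a: bounded-occurrence gap E3-CNFs, and the output length of `g` in power form
  obtain ⟨g, γ, B, hg, hγ, hgspec⟩ := stub_gapE3SATB L hL
  obtain ⟨s, hs⟩ := exists_poly_length_le_of_mem_FP hg
  obtain ⟨a, ha⟩ := poly_le_pow s
  -- S2b: the shape uniformiser; S4a: the conflict-graph code; S4b: the counting window
  obtain ⟨d, m, κ, hd, hm, hmpos, hκ, hdspec⟩ := stub_dupPad a
  obtain ⟨f, hf, hfspec⟩ := stub_conflictGraphFn
  obtain ⟨Δ, p, q, τ, len, hΔ, hq, hlam, hlenmono, hgap⟩ :=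
    stub_conflictGraphGap (max B 1) (κ * γ) (mul_pos hκ hγ)
  -- the total map and its per-input specification
  set T : List Bool → List Bool := f ∘ d ∘ fanoutFn g id with hT
  have hTFP : T ∈ FP := comp_mem_FP hf (comp_mem_FP hd (fanoutFn_mem_FP hg (PolyTimeComputable.id _)))
  have hTspec : ∀ y : List Bool, (T y).length = len (m y.length) ∧
      (y ∈ L → 8 * τ (m y.length) ≤ hardcoreCount Δ p q (T y)) ∧
      (y ∉ L → 0 < hardcoreCount Δ p q (T y) ∧ hardcoreCount Δ p q (T y) ≤ τ (m y.length)) := by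
    intro y
    obtain ⟨φ, hgy, hφ3, hocc, hyes, hno⟩ := hgspec y
    have hφlen : φ.length ≤ (y.length + 2) ^ a := by
      have h1 := SatDHamRed.three_mul_length_le_length_encode φ
      have h2 := hs y
      rw [hgy] at h2
      have h3 := ha y.length
      omega
    obtain ⟨ψ, hdφ, hψ3, hψlen, hψocc, hψsat, hψval⟩ := hdspec φ y hφ3 hφlen
    have hψpos : 0 < ψ.length := by rw [hψlen]; exact hmpos _
    have hTy : T y = f (encodingCNF.encode ψ) := by
      simp only [hT, Function.comp_apply, fanoutFn_apply, id, hgy, hdφ]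
    obtain ⟨hxlen, hxyes, hxno⟩ := hgap ψ hψ3 (hψocc B hocc) hψpos (T y) (by rw [hTy, hfspec ψ])
    rw [← hψlen]
    exact ⟨hxlen, fun hy => hxyes (hψsat (hyes hy)), fun hy => hxno (hψval γ (hno hy))⟩
  -- the twins
  set D₀ : Ensemble := fun n => (X₀ n).map T with hD₀
  set D₁ : Ensemble := fun n => (X₁ n).map T with hD₁
  set ℓ' : ℕ → ℕ := fun n => len (m (ℓ n)) with hℓ'
  have hℓ'mono : StrictMono ℓ' := hlenmono.comp (hm.comp hℓ)
  have hlen₀' : ∀ n, ∀ x ∈ (D₀ n).support, x.length = ℓ' n := by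
    intro n x hx
    obtain ⟨s, hs, rfl⟩ := (PMF.mem_support_map_iff _ _ _).1 hx
    rw [(hTspec s).1, hlen₀ n s hs]
  have hlen₁' : ∀ n, ∀ x ∈ (D₁ n).support, x.length = ℓ' n := by
    intro n x hx
    obtain ⟨s, hs, rfl⟩ := (PMF.mem_support_map_iff _ _ _).1 hx
    rw [(hTspec s).1, hlen₁ n s hs]
  -- samplable
  have hsamp₀ : D₀.IsPolySamplable := isPolySamplable_map' hX₀ hTFP
  have hsamp₁ : D₁.IsPolySamplable := isPolySamplable_map' hX₁ hTFP
  -- indistinguishable with the index (post-processing), then index-free (S5)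
  set F : List Bool → List Bool := T ∘ fun z => (boolUnpair z).2 with hF
  have hFFP : F ∈ FP := comp_mem_FP hTFP boolUnpairSnd_mem_FP
  have hFT : ∀ n (s : List Bool), F (boolPair (unaryEncodeNat n) s) = T s := by
    intro n s
    simp only [hF, Function.comp_apply, boolUnpair_boolPair]
  have hind' : IsCompIndistinguishable D₀ D₁ := by
    have hmap := IsCompIndistinguishable.map_fp (ℓ' := ℓ') hind hlen₀ hlen₁ hℓpoly hFFP
      (fun n s hs => by rw [hFT, (hTspec s).1, hs])
    have e₀ : (fun n => (X₀ n).map fun s => F (boolPair (unaryEncodeNat n) s)) = D₀ := by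
      funext n
      simp only [hD₀, hFT]
    have e₁ : (fun n => (X₁ n).map fun s => F (boolPair (unaryEncodeNat n) s)) = D₁ := by
      funext n
      simp only [hD₁, hFT]
    rw [e₀, e₁] at hmap
    exact hmap
  have hi := stub_clauseI D₀ D₁ ℓ' hℓ'mono hlen₀' hlen₁' hind'
  -- clause (ii) with the explicit threshold schedule
  set t : ℕ → ℕ := fun n => τ (m (ℓ n)) with ht
  have ha : Tendsto (fun n : ℕ => D₀.prob n {x | 8 * t n ≤ hardcoreCount Δ p q x}) atTop (nhds 1) := by
    refine tendsto_const_nhds.congr fun n => ?_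
    show (1 : ℝ) = (((X₀ n).map T).toOuterMeasure {x | 8 * t n ≤ hardcoreCount Δ p q x}).toReal
    rw [PMF.toOuterMeasure_map_apply, (PMF.toOuterMeasure_apply_eq_one_iff _ _).2, ENNReal.toReal_one]
    intro s hs
    show 8 * t n ≤ hardcoreCount Δ p q (T s)
    have h8 := (hTspec s).2.1 (hsub n s hs)
    rwa [hlen₀ n s hs] at h8
  have hb : Tendsto (fun n : ℕ => D₁.prob n {x | 0 < hardcoreCount Δ p q x ∧ hardcoreCount Δ p q x ≤ t n})
      atTop (nhds 1) := by
    have hlow : Tendsto (fun n : ℕ => 1 - X₁.prob n {s | s ∈ L}) atTop (nhds 1) := by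
      simpa using (tendsto_const_nhds (x := (1 : ℝ))).sub hmiss
    refine tendsto_of_tendsto_of_tendsto_of_le_of_le hlow tendsto_const_nhds (fun n => ?_)
      (fun n => Ensemble.prob_le_one _ _ _)
    -- `1 - Pr_{X₁ n}[L] = Pr_{X₁ n}[Lᶜ] ≤ Pr_{X₁ n}[T ⁻¹' E₁] = Pr_{D₁ n}[E₁]`
    have hcompl : 1 - X₁.prob n {s | s ∈ L} = ((X₁ n).toOuterMeasure {s | s ∈ L}ᶜ).toReal := by
      have := Summit.PneNP.PneNP.Theorems.PseudorandomTwinsAbove.Negative.mass_add_compl (X₁ n) {s | s ∈ L}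
      simp only [Ensemble.prob]
      linarith
    rw [hcompl]
    show ((X₁ n).toOuterMeasure {s | s ∈ L}ᶜ).toReal ≤
      (((X₁ n).map T).toOuterMeasure {x | 0 < hardcoreCount Δ p q x ∧ hardcoreCount Δ p q x ≤ t n}).toReal
    rw [PMF.toOuterMeasure_map_apply]
    refine ENNReal.toReal_mono
      (Summit.PneNP.PneNP.Theorems.PseudorandomTwinsAbove.Negative.toOuterMeasure_ne_top' _ _)
      (PMF.toOuterMeasure_mono _ ?_)
    rintro s ⟨hsL, hs⟩
    have hsL' : s ∉ L := fun h' => hsL h'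
    show 0 < hardcoreCount Δ p q (T s) ∧ hardcoreCount Δ p q (T s) ≤ t n
    have h8 := (hTspec s).2.2 hsL'
    rwa [hlen₁ n s hs] at h8
  -- the crux, by name (its inlined count/threshold are `hardcoreCount`/`hardCoreThreshold`, `rfl`)
  exact ⟨Δ, p, q, hΔ, hq, hlam, D₀, D₁, hsamp₀, hsamp₁, hi, t, ha, hb⟩

end Summit.PneNP.PneNP.Cruxes.PseudorandomTwinsAbove.PrgImageExactThresholdLift

end
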